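import Summits.QuantumAdvantage.QuantumAdvantage.Theorems.CubicForrelationNearExactIsExactCubicFormTransport
import Summits.QuantumAdvantage.QuantumAdvantage.Theorems.CubicForrelationNearExactIsExactCubicFormFrame
import Summits.QuantumAdvantage.QuantumAdvantage.Theorems.CubicForrelationNearExactIsExactKtThreeTools
import Summits.QuantumAdvantage.QuantumAdvantage.Theorems.CubicForrelationNearExactIsExactTwelveOddWeightLight

/-!
# Crux `CubicForrelation.NearExactIsExact` (stmt-QuantumAdvantage-14043) — the ADAPTED R2 FRAME of a cubic with a rank-2 derivative

Certificate seat `b2b-cforr-cert` (gen 40).  HONEST FRAMING: kernel-checked packaging (standard axioms) of the "(L4) R2 frame" of the Lean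
roadmap for `E1280-even` (HOME/b2b-cforr-cert-g39/E1280-HANDPROOFS.md §3): it combines `kt3_minweight_quadratic_cells` (the derivative is the
indicator of a codimension-2 flat), …CubicFormFrame (an invertible frame adapted to it) and …CubicFormTransport (degree, weight and the
derivative in the new frame).  Nothing about `θ₁₂`; NOT summit progress.

* `tcr2_adapted` (**main**): let `κ` be a cubic on `3 + m` bits and `a ≠ 0` a direction with `#{x : κ(x) ≠ κ(x ⊕ a)} = 2^{m+1}` (a rank-2
  derivative).  Then there are `P, Pi` over `𝔽₂` with `P Pi = Pi P = 1`, column `0` of `P` equal to `a`, and bits `c₁, c₂` such that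
  `κ' = κ ∘ (0 ⊕ P·)` is cubic, has the same number of ones as `κ`, and `D_{e₀}κ'(y) = (y₁ ⊕ c₁)(y₂ ⊕ c₂)` — the hypothesis `hD` of
  …CubicFormCells (`tcc_weight`, `tcc_second_rho`, …); the cubic form of `κ'` is the `P`-transform of that of `κ`
  (`tct_third_comp_coord`) and a pairing partner travels along (`tps_pair_covariant`, with `tcr2_matrix_inv`).
* `tcr2_matrix_inv`: the entrywise inverse identities as the matrix identity `Pi * P = 1` consumed by `tps_pair_covariant`.

References: T. Kasami, N. Tokura (1970) Thm 1; F. J. MacWilliams, N. J. A. Sloane (1977) Ch. 13 §4, Ch. 15 §2.  Axioms: the standard three.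
-/

set_option linter.dupNamespace false -- D-0017: single-problem summit ⇒ `QuantumAdvantage.QuantumAdvantage` by design

namespace Summit.QuantumAdvantage.QuantumAdvantage.Theorems.CubicForrelation.NearExactIsExact

open Finset
open Literature.Computability.QuantumComplexity
open Literature.Computability.QuantumComplexity.BuzetChailloux (bxor zeroVec bxor_comm bxor_self bxor_zeroVec zeroVec_bxor
  bxor_bxor_cancel_left)

variable {m : ℕ}

/-- The entrywise identities `Σ_φ Pi_{ψφ} P_{φω} = [ψ = ω]` as the matrix identity `Pi * P = 1`. [folklore] -/
theorem tcr2_matrix_inv {N : ℕ} (P Pi : Fin N → Fin N → ZMod 2) (h : ∀ ψ ω, (∑ φ, Pi ψ φ * P φ ω) = if ψ = ω then 1 else 0) :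
    (Matrix.of fun ψ φ => Pi ψ φ) * (Matrix.of fun ψ φ => P ψ φ) = 1 := by
  ext ψ ω
  rw [Matrix.mul_apply, Matrix.one_apply]
  exact h ψ ω

/-- **The adapted R2 frame.**  For a cubic `κ` on `3 + m` bits and a direction `a ≠ 0` with `#{x : κ(x) ≠ κ(x⊕a)} = 2^{m+1}` there are
`P, Pi` (`P Pi = Pi P = 1`, column `0` of `P` is `a`) and bits `c₁, c₂` such that `κ' = κ ∘ (0 ⊕ P·)` is cubic with `#κ' = #κ` and
`D_{e₀}κ'(y) = (y₁ ⊕ c₁)(y₂ ⊕ c₂)` for all `y`. [this work] -/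
theorem tcr2_adapted (κ : (Fin (3 + m) → Bool) → Bool) (hκ : IsDegLeFun 3 κ) (a : Fin (3 + m) → Bool) (ha : a ≠ zeroVec)
    (hDa : #(univ.filter fun x : Fin (3 + m) → Bool => (κ x ^^ κ (bxor x a)) = true) = 2 ^ (m + 1)) :
    ∃ (P Pi : Fin (3 + m) → Fin (3 + m) → ZMod 2) (c₁ c₂ : Bool),
      (∀ ψ ω, (∑ φ, P ψ φ * Pi φ ω) = if ψ = ω then 1 else 0) ∧
      (∀ ψ ω, (∑ φ, Pi ψ φ * P φ ω) = if ψ = ω then 1 else 0) ∧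
      (∀ ψ, P ψ (Fin.castAdd m (0 : Fin 3)) = if a ψ = true then 1 else 0) ∧
      let κ' : (Fin (3 + m) → Bool) → Bool :=
        fun y => κ (bxor zeroVec (fun ψ => decide ((∑ φ, P ψ φ * (if y φ = true then (1 : ZMod 2) else 0)) = 1)))
      IsDegLeFun 3 κ' ∧
      (univ.filter fun y : Fin (3 + m) → Bool => κ' y = true).card = (univ.filter fun x : Fin (3 + m) → Bool => κ x = true).card ∧
      ∀ y, (κ' y ^^ κ' (bxor y (fun l => decide (l = Fin.castAdd m (0 : Fin 3))))) =
        ((y (Fin.castAdd m (1 : Fin 3)) ^^ c₁) && (y (Fin.castAdd m (2 : Fin 3)) ^^ c₂)) := by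
  classical
  -- the derivative is the indicator of a codimension-2 flat
  have hq : IsDegLeFun 2 (fun x => κ x ^^ κ (bxor x a)) := stub_derivDegree (3 + m) 2 κ a hκ
  have h4 : 4 * #(univ.filter fun x : Fin (3 + m) → Bool => (κ x ^^ κ (bxor x a)) = true) = 2 ^ (3 + m) := by
    rw [hDa, pow_add, pow_add]; norm_num; ring
  obtain ⟨z₁, z₂, b₁, b₂, hz₁, hz₂, h12, hU⟩ := kt3_minweight_quadratic_cells (fun x => κ x ^^ κ (bxor x a)) hq h4
  -- `⟨a, z_i⟩ = 0`: the flat is invariant under `x ↦ x ⊕ a`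
  obtain ⟨x₀, hx₀⟩ : ∃ x₀, (κ x₀ ^^ κ (bxor x₀ a)) = true := by
    by_contra hno
    push Not at hno
    have : #(univ.filter fun x : Fin (3 + m) → Bool => (κ x ^^ κ (bxor x a)) = true) = 0 := by
      rw [card_eq_zero, filter_eq_empty_iff]; intro x _; exact hno x
    rw [this] at hDa
    exact absurd hDa (by positivity)
  have hx₀' : (κ (bxor x₀ a) ^^ κ (bxor (bxor x₀ a) a)) = true := by
    rw [iw_bxor_assoc, bxor_self, bxor_zeroVec, Bool.xor_comm]; exact hx₀
  have hpa : ∀ (z : Fin (3 + m) → Bool) (b : Bool),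
      decide (Odd #(univ.filter fun i => (x₀ i && z i) = true)) = b →
      decide (Odd #(univ.filter fun i => ((bxor x₀ a) i && z i) = true)) = b →
      decide (Odd #(univ.filter fun j => a j && z j)) = false := by
    intro z b h1 h2
    have h3 := tow_parity_bxor x₀ a z
    rw [h1, h2] at h3
    revert h3; cases b <;> cases decide (Odd #(univ.filter fun j => a j && z j)) <;> simp
  have ha₁ := hpa z₁ b₁ ((hU x₀).1 hx₀).1 ((hU _).1 hx₀').1
  have ha₂ := hpa z₂ b₂ ((hU x₀).1 hx₀).2 ((hU _).1 hx₀').2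
  -- the frame
  obtain ⟨P, Pi, hPPi, hPiP, hP0, hPz₁, hPz₂⟩ := tcr_adapted_frame a z₁ z₂ ha hz₁ hz₂ h12 ha₁ ha₂
  refine ⟨P, Pi, !b₁, !b₂, hPPi, hPiP, hP0, ?_⟩
  intro κ'
  refine ⟨tct_comp_isDegLeFun κ hκ P zeroVec, tct_card_comp_eq P Pi κ hPPi hPiP zeroVec, fun y => ?_⟩
  -- the derivative along `e₀` in the new frame
  set L : (Fin (3 + m) → Bool) → (Fin (3 + m) → Bool) :=
    fun y => fun ψ => decide ((∑ φ, P ψ φ * (if y φ = true then (1 : ZMod 2) else 0)) = 1) with hL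
  have hLe : L (fun l => decide (l = Fin.castAdd m (0 : Fin 3))) = a := by
    have h := tct_lin_single P (Fin.castAdd m (0 : Fin 3))
    have : L (fun l => decide (l = Fin.castAdd m (0 : Fin 3))) =
        fun ψ => decide ((∑ φ', P ψ φ' * (if decide (φ' = Fin.castAdd m (0 : Fin 3)) = true then (1 : ZMod 2) else 0)) = 1) := rfl
    rw [this, h]
    funext ψ
    rw [hP0]
    cases a ψ <;> decide
  have hadd : L (bxor y (fun l => decide (l = Fin.castAdd m (0 : Fin 3)))) = bxor (L y) a := by
    rw [show L (bxor y (fun l => decide (l = Fin.castAdd m (0 : Fin 3)))) =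
      bxor (L y) (L (fun l => decide (l = Fin.castAdd m (0 : Fin 3)))) from tct_lin_bxor P y _, hLe]
  show (κ (bxor zeroVec (L y)) ^^ κ (bxor zeroVec (L (bxor y (fun l => decide (l = Fin.castAdd m (0 : Fin 3))))))) = _
  rw [hadd, zeroVec_bxor, zeroVec_bxor]
  -- read the flat in the new coordinates
  have hiff := hU (L y)
  have e1 : decide (Odd #(univ.filter fun i => ((L y) i && z₁ i) = true)) = y (Fin.castAdd m (1 : Fin 3)) := by
    rw [← hPz₁ y]
  have e2 : decide (Odd #(univ.filter fun i => ((L y) i && z₂ i) = true)) = y (Fin.castAdd m (2 : Fin 3)) := by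
    rw [← hPz₂ y]
  rw [e1, e2] at hiff
  revert hiff
  cases (κ (L y) ^^ κ (bxor (L y) a)) <;> cases y (Fin.castAdd m (1 : Fin 3)) <;> cases y (Fin.castAdd m (2 : Fin 3)) <;>
    cases b₁ <;> cases b₂ <;> simp

end Summit.QuantumAdvantage.QuantumAdvantage.Theorems.CubicForrelation.NearExactIsExact
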